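import Summits.ResolutionOfSingularities.ResolutionOfSingularities.Theorems.HomologicalConductorNoZenoPointBlowupRegularPoint
import Literature.AlgebraicGeometry.Resolution.SaturatedIdealSheaf
import Literature.AlgebraicGeometry.Resolution.FormalNormalCrossingsEtale
import Literature.AlgebraicGeometry.Resolution.Blowups
import HarnessLib

/-!
# Crux `NoZenoR` (stmt-ResolutionOfSingularities-19943), slot 5 `stub_L1wCoreF`, (B1) UP-5 — at a node of a finite centre:
# `h⁰` is local over the base, so UP-5a/b hold fibrewise for `X¹ = Bl_{sepNodes} X`

OURS (cell res-hironaka, crux chain W4.4, seat res-L0-w44-stub-1 g11; object UP-5a/b of the (B1) split core of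
slot 5 `stub_L1wCoreF`, res-L0-w44-stub-2 L1W-PREP §3.3 / lead B1-CENSUS-g8). Nothing here is a statement of the
manuscript under review (Hironaka 2017); AI-written, weaker than expert review. Def-free, fact-free.

The consumer's blow-up (`IsSepX1Sandwiched`) is along the reduced ideal of the finite closed set
`Z = cl(sepNodes π)` of a resolution `X`, not of one point. This file localises UP-5a/b
(`…PointBlowupRegularPoint`) to a node:

* `algebraMap_sections_top`, **`h0_comap_of_isOpenImmersion`** — `h0 (ι' ≫ f) (K·𝒪_Y) = h0 f K` for an
  open immersion `ι' : Y → X` containing `supp K` (`V(K·𝒪_Y) = V(K) ×_X Y ≅ V(K)`, Mathlib `comapIso`,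
  `IsOpenImmersion.range_pullbackSnd`, `isIso_iff_isOpenImmersion_and_surjective`);
* `isClosed_singleton_opens`, **`comap_ι_vanishingIdeal_eq_singleton`** — for `Z ∩ U = {x}`:
  `𝓘_Z·𝒪_U = 𝓘_{x}` on the open subscheme `U` (tree `radical_comap_of_isOpenImmersion`,
  `vanishingIdeal_preimage_eq_radical_comap`);
* **`h0_comap_vanishingIdeal_node`** — for
  `IsBlowup ρ (vanishingIdeal Z)` (`X` locally Noetherian, `X'` integral), a closed point `x ∈ Z`
  isolated in `Z` with `𝒪_{X,x}` regular of dimension `2`, and any `π : X → Spec S`: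
  `h0 (ρ ≫ π) (𝓘_{x}·𝒪_{X'}) = h0 π 𝓘_{x}`, `h0 (ρ ≫ π) ((𝓘_{x}·𝒪_{X'})²) = 3 · h0 π 𝓘_{x}`, hence
  `h0 ((𝓘_{x}·𝒪_{X'})²) = 3 · h0 (𝓘_{x}·𝒪_{X'})`: THE NODE CURVE `n_x` IS OF THE FIRST KIND (the hypothesis
  `h0 π (𝓘 ^ 2) = 3 * h0 π 𝓘` of `Lipman1969_27_1_reg_rat`, L1W-PREP STEP 3 (2)/(4)), via `IsBlowup.restrict`
  to `ρ⁻¹U → U` and the locality of `h0`.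

References: J. Lipman, Publ. Math. IHÉS 36 (1969), §15 p. 229, §27 (27.1) [`Lipman1969`]; U. Görtz,
T. Wedhorn, *Algebraic Geometry I* (2020), Prop. 13.91 (blow-ups restrict over opens) [`GortzWedhorn2020`].
-/

noncomputable section

-- single-problem summit: the doubled namespace component `ResolutionOfSingularities` is forced
set_option linter.dupNamespace false

namespace Summit.ResolutionOfSingularities.ResolutionOfSingularities.Theorems.NoZeno.ExcCount.PointBlowup

open CategoryTheory CategoryTheory.Limits AlgebraicGeometry TopologicalSpace Opposite
open Literature.AlgebraicGeometry.Resolution Literature.AlgebraicGeometry.Morphisms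

universe u

/-! ## §13 `h⁰` is local over the base; restricting a finite centre to one of its points -/

section Restrict

variable {S : Type u} [CommRing S]

/-- The structure map of `Sections g ⊤` is `g.appTop` after `Γ(Spec S) ≅ S`. [folklore] -/
theorem algebraMap_sections_top {V : Scheme.{u}} (g : V ⟶ Spec (.of S)) (s : S) :
    algebraMap S (Sections g ⊤) s = g.appTop ((Scheme.ΓSpecIso (.of S)).inv s) := by
  rw [Sections.algebraMap_apply]
  change (g.appTop ≫ V.presheaf.map (homOfLE (le_top : (⊤ : V.Opens) ≤ ⊤)).op) _ = _
  have : (homOfLE (le_top : (⊤ : V.Opens) ≤ ⊤)) = 𝟙 _ := Subsingleton.elim _ _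
  rw [this, op_id, V.presheaf.map_id, Category.comp_id]

/-- **`h⁰` is insensitive to shrinking `X` to an open containing the support**: for an open immersion
`ι' : Y → X` whose image contains `supp K`, `h0 (ι' ≫ f) (K·𝒪_Y) = h0 f K` (`V(K·𝒪_Y) = V(K) ×_X Y ≅ V(K)`).
[folklore] -/
theorem h0_comap_of_isOpenImmersion {X Y : Scheme.{u}} (f : X ⟶ Spec (.of S)) (ι' : Y ⟶ X)
    [IsOpenImmersion ι'] (K : X.IdealSheafData)
    (hK : (K.support : Set X) ⊆ Set.range ι'.base) :
    h0 (ι' ≫ f) (K.comap ι') = h0 f K := by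
  -- `V(K·𝒪_Y) ≅ V(K) ×_X Y`, and the second projection is a surjective open immersion
  have hsurj : Function.Surjective (pullback.snd ι' K.subschemeι).base := by
    intro p
    have hp : K.subschemeι.base p ∈ (K.support : Set X) := by
      rw [← Scheme.IdealSheafData.range_subschemeι]; exact ⟨p, rfl⟩
    obtain ⟨y, hy⟩ := hK hp
    have : p ∈ Set.range (pullback.snd ι' K.subschemeι).base := by
      rw [IsOpenImmersion.range_pullbackSnd]
      exact ⟨y, hy⟩
    exact this
  haveI : IsIso (pullback.snd ι' K.subschemeι) :=
    (isIso_iff_isOpenImmersion_and_surjective _).mpr ⟨inferInstance, ⟨hsurj⟩⟩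
  let e : (K.comap ι').subscheme ≅ K.subscheme :=
    K.comapIso ι' ≪≫ asIso (pullback.snd ι' K.subschemeι)
  have he : e.hom ≫ K.subschemeι = (K.comap ι').subschemeι ≫ ι' := by
    change (_ ≫ pullback.snd ι' K.subschemeι) ≫ _ = _
    rw [Category.assoc, ← pullback.condition, ← Category.assoc,
      Scheme.IdealSheafData.comapIso_hom_fst]
  -- global sections
  let θ : Γ(K.subscheme, ⊤) ≅ Γ((K.comap ι').subscheme, ⊤) := Scheme.Γ.mapIso e.op
  have hθ : θ.hom = e.hom.appTop := rfl
  rw [h0_eq, h0_eq]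
  symm
  refine length_eq_of_ringEquiv θ.commRingCatIsoToRingEquiv fun s => ?_
  change θ.hom (algebraMap S (Sections (K.subschemeι ≫ f) ⊤) s) =
    algebraMap S (Sections ((K.comap ι').subschemeι ≫ ι' ≫ f) ⊤) s
  rw [hθ, algebraMap_sections_top, algebraMap_sections_top, ← CategoryTheory.comp_apply,
    ← Scheme.Hom.comp_appTop, ← Category.assoc, he, Category.assoc]

/-- `{x'}` is closed in the open subscheme `U` when `{x}` is closed in `X` (`x' = x`). [folklore] -/
theorem isClosed_singleton_opens {X : Scheme.{u}} (U : X.Opens) (x : X) (hxU : x ∈ U)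
    (hx : IsClosed ({x} : Set X)) : IsClosed ({(⟨x, hxU⟩ : ↥(U : Scheme.{u}))} : Set ↥(U : Scheme.{u})) := by
  have : ({(⟨x, hxU⟩ : ↥(U : Scheme.{u}))} : Set ↥(U : Scheme.{u})) = U.ι.base ⁻¹' {x} := by
    ext p
    simp only [Set.mem_singleton_iff, Set.mem_preimage]
    constructor
    · rintro rfl; rfl
    · intro h; exact Subtype.ext h
  rw [this]
  exact hx.preimage U.ι.base.hom.continuous

/-- **Restricting a reduced centre to an open on which it is a single point**: for a closed `Z ⊆ X`
and an open `U` with `Z ∩ U = {x}`, `𝓘_Z·𝒪_U = 𝓘_{x}` on the open subscheme `U` (both are the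
reduced ideal of `{x}`: tree `radical_comap_of_isOpenImmersion`, `vanishingIdeal_preimage_eq_radical_comap`).
[folklore] -/
theorem comap_ι_vanishingIdeal_eq_singleton {X : Scheme.{u}} (Z : Closeds X) (U : X.Opens) (x : X)
    (hxU : x ∈ U) (hx : IsClosed ({x} : Set X)) (hZU : (Z : Set X) ∩ U = {x}) :
    (Scheme.IdealSheafData.vanishingIdeal Z).comap U.ι =
      Scheme.IdealSheafData.vanishingIdeal
        (⟨{(⟨x, hxU⟩ : ↥(U : Scheme.{u}))}, isClosed_singleton_opens U x hxU hx⟩ :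
          Closeds ↥(U : Scheme.{u})) := by
  have hsupp : (Scheme.IdealSheafData.vanishingIdeal Z).support = Z :=
    Closeds.ext (Scheme.IdealSheafData.coe_support_vanishingIdeal Z)
  have hrad : (Scheme.IdealSheafData.vanishingIdeal Z).radical =
      Scheme.IdealSheafData.vanishingIdeal Z := by
    rw [← Scheme.IdealSheafData.vanishingIdeal_support, hsupp]
  rw [← radical_comap_of_isOpenImmersion _ hrad U.ι]
  have h := (vanishingIdeal_preimage_eq_radical_comap U.ι Z.isClosed).symm
  have hZ : (⟨(Z : Set X), Z.isClosed⟩ : Closeds X) = Z := rfl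
  rw [hZ] at h
  rw [h]
  congr 1
  apply Closeds.ext
  ext p
  constructor
  · intro (hp : U.ι.base p ∈ (Z : Set X))
    have : U.ι.base p ∈ (Z : Set X) ∩ U := ⟨hp, p.2⟩
    rw [hZU, Set.mem_singleton_iff] at this
    exact Set.mem_singleton_iff.mpr (Subtype.ext this)
  · intro hp
    have hp' : p = ⟨x, hxU⟩ := Set.mem_singleton_iff.mp hp
    rw [hp']
    have : x ∈ (Z : Set X) ∩ U := by rw [hZU]; exact rfl
    exact this.1

end Restrict

/-! ## §14 UP-5 at a node of a finite centre -/

section Node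

variable {S : Type u} [CommRing S] {X X' : Scheme.{u}} [IsLocallyNoetherian X] [IsIntegral X']
  (π : X ⟶ Spec (.of S)) (ρ : X' ⟶ X) (Z : Closeds X)
  (hρ : IsBlowup ρ (Scheme.IdealSheafData.vanishingIdeal Z))
  (x : X) (hx : IsClosed ({x} : Set X)) (U : X.Opens) (hxU : x ∈ U)
  (hZU : (Z : Set X) ∩ U = {x})
  [IsRegularLocalRing (X.presheaf.stalk x)] (hdim : ringKrullDim (X.presheaf.stalk x) = 2)

include hρ hxU hZU hdim in
/-- **UP-5a/b at an ISOLATED POINT of the centre.** Let `ρ : X' → X` be a blowing up of the reduced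
ideal of a closed `Z ⊆ X` (`X` locally Noetherian, `X'` integral) and `x ∈ Z` a closed point, isolated in
`Z` (`Z ∩ U = {x}` for an open `U`), with `𝒪_{X,x}` regular of dimension `2` — e.g. a node of
`Z = cl(sepNodes)` on a resolution `X`. Then for the exceptional curve `F_x = V(𝓘_{x}·𝒪_{X'})` over `x`:
`h0 (ρ ≫ π) (𝓘_{x}·𝒪_{X'}) = h0 π 𝓘_{x}` and `h0 (ρ ≫ π) ((𝓘_{x}·𝒪_{X'})²) = 3 · h0 π 𝓘_{x}`
(restrict to `ρ⁻¹U → U`, where the centre is `𝓘_{x}`; `h0` does not see the restriction,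
`h0_comap_of_isOpenImmersion`); rewriting the two conjuncts gives the FIRST-KIND form
`h0 ((𝓘_{x}·𝒪_{X'})²) = 3 · h0 (𝓘_{x}·𝒪_{X'})` (same text as `h0_comap_vanishingIdeal_point_sq_eq_three_mul`).
[this work] -/
theorem h0_comap_vanishingIdeal_node :
    h0 (ρ ≫ π) ((Scheme.IdealSheafData.vanishingIdeal ⟨{x}, hx⟩).comap ρ) =
        h0 π (Scheme.IdealSheafData.vanishingIdeal ⟨{x}, hx⟩) ∧
      h0 (ρ ≫ π) ((Scheme.IdealSheafData.vanishingIdeal ⟨{x}, hx⟩).comap ρ ^ 2) =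
        3 * h0 π (Scheme.IdealSheafData.vanishingIdeal ⟨{x}, hx⟩) := by
  -- the point `x' = x` of the open subscheme `U`
  set x' : ↥(U : Scheme.{u}) := ⟨x, hxU⟩ with hx'
  have hx'c : IsClosed ({x'} : Set ↥(U : Scheme.{u})) := isClosed_singleton_opens U x hxU hx
  -- its local ring is `𝒪_{X,x}`
  let est : X.presheaf.stalk x ≃+* (U : Scheme.{u}).presheaf.stalk x' :=
    (asIso (U.ι.stalkMap x')).commRingCatIsoToRingEquiv
  haveI : IsRegularLocalRing ((U : Scheme.{u}).presheaf.stalk x') := IsRegularLocalRing.of_ringEquiv est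
  have hdim' : ringKrullDim ((U : Scheme.{u}).presheaf.stalk x') = 2 := by
    rw [← ringKrullDim_eq_of_ringEquiv est]; exact hdim
  -- the restricted blow-up `ρ⁻¹U → U` blows up `𝓘_{x'}`
  have hJU : (Scheme.IdealSheafData.vanishingIdeal Z).comap U.ι =
      Scheme.IdealSheafData.vanishingIdeal ⟨{x'}, hx'c⟩ :=
    comap_ι_vanishingIdeal_eq_singleton Z U x hxU hx hZU
  have hJU' : (Scheme.IdealSheafData.vanishingIdeal ⟨{x}, hx⟩).comap U.ι =
      Scheme.IdealSheafData.vanishingIdeal ⟨{x'}, hx'c⟩ :=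
    comap_ι_vanishingIdeal_eq_singleton ⟨{x}, hx⟩ U x hxU hx
      (by ext y; simp only [Set.mem_inter_iff, Set.mem_singleton_iff, Closeds.coe_mk]
          exact ⟨fun h => h.1, fun h => ⟨h, h ▸ hxU⟩⟩)
  have hρ' : IsBlowup (ρ ∣_ U) (Scheme.IdealSheafData.vanishingIdeal ⟨{x'}, hx'c⟩) := by
    rw [← hJU]; exact hρ.restrict U
  -- `ρ⁻¹U` is integral (non-empty: it contains the fibre over `x`)
  have hne : IsLocalRing.maximalIdeal (X.presheaf.stalk x) ≠ ⊥ := by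
    intro hbot
    have hf : IsField (X.presheaf.stalk x) := (IsLocalRing.isField_iff_maximalIdeal_eq).mpr hbot
    have := ringKrullDim_eq_zero_of_isField hf
    rw [hdim] at this
    exact absurd this (by decide)
  have hne' : IsLocalRing.maximalIdeal ((U : Scheme.{u}).presheaf.stalk x') ≠ ⊥ := by
    intro hbot
    have hf : IsField ((U : Scheme.{u}).presheaf.stalk x') :=
      (IsLocalRing.isField_iff_maximalIdeal_eq).mpr hbot
    have := ringKrullDim_eq_zero_of_isField hf
    rw [hdim'] at this
    exact absurd this (by decide)
  have hirr : IsIrreducible ((ρ ∣_ U).base ⁻¹' {x'}) :=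
    hρ'.isIrreducible_preimage_singleton x' (stalkIdeal_vanishingIdeal_singleton hx'c) hne'
  obtain ⟨p₀, -⟩ := hirr.nonempty
  haveI : Nonempty (ρ ⁻¹ᵁ U : X'.Opens) := ⟨p₀⟩
  -- the engine on `ρ⁻¹U → U → Spec S`
  have key1 := h0_comap_vanishingIdeal_point (U.ι ≫ π) (ρ ∣_ U) x' hx'c hdim' hρ'
  have key2 := h0_comap_vanishingIdeal_point_sq (U.ι ≫ π) (ρ ∣_ U) x' hx'c hdim' hρ'
  -- transport along the open immersions `ρ⁻¹U ↪ X'` and `U ↪ X`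
  have hsuppx : ((Scheme.IdealSheafData.vanishingIdeal ⟨{x}, hx⟩).support : Set X) ⊆
      Set.range U.ι.base := by
    rw [Scheme.IdealSheafData.coe_support_vanishingIdeal, Scheme.Opens.range_ι]
    intro y hy
    have hy' : y = x := hy
    rw [hy']; exact hxU
  have hsupp1 : (((Scheme.IdealSheafData.vanishingIdeal ⟨{x}, hx⟩).comap ρ).support : Set X') ⊆
      Set.range (ρ ⁻¹ᵁ U).ι.base := by
    rw [Scheme.IdealSheafData.support_comap, Scheme.Opens.range_ι]
    intro y hy
    have hy' : ρ.base y ∈ ((Scheme.IdealSheafData.vanishingIdeal ⟨{x}, hx⟩).support : Set X) := hy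
    rw [Scheme.IdealSheafData.coe_support_vanishingIdeal] at hy'
    change ρ.base y ∈ ({x} : Set X) at hy'
    rw [Set.mem_singleton_iff] at hy'
    change ρ.base y ∈ U
    rw [hy']; exact hxU
  have hsupp2 : (((Scheme.IdealSheafData.vanishingIdeal ⟨{x}, hx⟩).comap ρ ^ 2).support : Set X') ⊆
      Set.range (ρ ⁻¹ᵁ U).ι.base := by
    rw [Scheme.IdealSheafData.support_pow (n := 2) (hn := two_ne_zero)]; exact hsupp1
  have hmor : (ρ ⁻¹ᵁ U).ι ≫ ρ ≫ π = (ρ ∣_ U) ≫ U.ι ≫ π := by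
    rw [← Category.assoc, ← morphismRestrict_ι, Category.assoc]
  have hideal : ((Scheme.IdealSheafData.vanishingIdeal ⟨{x}, hx⟩).comap ρ).comap (ρ ⁻¹ᵁ U).ι =
      (Scheme.IdealSheafData.vanishingIdeal ⟨{x'}, hx'c⟩).comap (ρ ∣_ U) := by
    rw [← Scheme.IdealSheafData.comap_comp, ← morphismRestrict_ι, Scheme.IdealSheafData.comap_comp,
      hJU']
  have hR : h0 π (Scheme.IdealSheafData.vanishingIdeal ⟨{x}, hx⟩) =
      h0 (U.ι ≫ π) (Scheme.IdealSheafData.vanishingIdeal ⟨{x'}, hx'c⟩) := by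
    rw [← h0_comap_of_isOpenImmersion π U.ι _ hsuppx, hJU']
  constructor
  · rw [← h0_comap_of_isOpenImmersion (ρ ≫ π) (ρ ⁻¹ᵁ U).ι _ hsupp1, hmor, hideal, key1, hR]
  · rw [← h0_comap_of_isOpenImmersion (ρ ≫ π) (ρ ⁻¹ᵁ U).ι _ hsupp2, comap_pow, hmor, hideal, key2,
      hR]

end Node

end Summit.ResolutionOfSingularities.ResolutionOfSingularities.Theorems.NoZeno.ExcCount.PointBlowup

end
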